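import Literature.NumberTheory.Automorphic.Qian2022HLTTConj
import Literature.NumberTheory.Automorphic.ReciprocityGLnRestrictionProofs
import Literature.NumberTheory.Automorphic.BaseChangeOfAutomorphicInduction
import Literature.NumberTheory.Automorphic.QuadraticCharacterTwist
import Literature.NumberTheory.Automorphic.AutomorphicInductionOfSelfTwist
import Literature.NumberTheory.GaloisRepresentations.InducedSelfTwist
import Literature.NumberTheory.GaloisRepresentations.InducedRestrictCompositumBlocks
import Literature.NumberTheory.GaloisRepresentations.ToLocalRestrictField
import Literature.NumberTheory.GaloisRepresentations.LocalGaloisGroupInertiaProofs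
import Literature.NumberTheory.GaloisRepresentations.TateTwistFrobeniusProofs
import Literature.NumberTheory.GaloisRepresentations.RestrictFieldSemisimpleFiniteProofs
import Literature.NumberTheory.GaloisRepresentations.AbsIrreducibleIndexTwo
import Literature.NumberTheory.GaloisRepresentations.FramedRepBlockSum
import Literature.NumberTheory.GaloisRepresentations.ResidualRepRestrict
import Literature.NumberTheory.PAdicHodge.LocallyCyclotomicCharacterDeRham
import Literature.RepresentationTheory.Semisimple.Semisimplification
import Literature.RepresentationTheory.Semisimple.Twist
import Mathlib.NumberTheory.NumberField.CMField
import HarnessLib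
import HarnessLib

/-!
# Bookkeeping lemmas for the Arthur–Clozel descent of an induced representation along a quadratic
# extension (self-twist on Satake parameters; regular algebraicity of the descended representation;
# Frobenius matching)

Topic `Literature/NumberTheory/Automorphic`.  PROVED lemmas (no new definitions), split out of the
stub-3' proof file of crux `stmt-Langlands-17000` (`NonParallelVoid.TwistedInductionParallel`, line
`symmetrise-pd-split`; wave-2 stub worker of `prover-line-stmt-Langlands-17000-0`, 2026-08-17) to respect
the 400-line cap of Theorems files; all statements are route-independent:

* §1 `eventually_satake_map_neg_eq` — the self-twist `Ind W ⊗ η_{E/K} ≅ Ind W` (`induce_twist_eq_conj`)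
  read on the Satake parameters of an HLTT-compatible `π`: at the places of `K'` inert in `E K'` the
  Satake multiset is stable under `x ↦ -x`.
* §2 `isRegularAlgebraic_of_isAutomorphicInductionAlong_two_two` — regular algebraicity descends along
  automorphic induction of degree two (Henniart's archimedean description + existence of infinity types).
* §3 `eventually_frobenius_match` — Frobenius characteristic polynomials of `(r₁ ⊕ r₂) ⊗ ε⁻¹` and of
  `(Ind W)|_{E'}` agree at almost all places (`arithFrobPolyOfSatake_two_mul_two`,
  `univ_eq_pair_of_finrank_eq_two`).
[cite: ArthurClozelAMS120, Ch. 3 Thm. 4.2 (b) and §6] [cite: HarrisLanTaylorThorneRMS2016, Thm. A]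
-/

noncomputable section

open scoped NumberField MatrixGroups Matrix Polynomial IntermediateField Classical
open NumberField IsDedekindDomain Field Filter Polynomial
open Literature.NumberTheory.GaloisRepresentations Literature.NumberTheory.PAdicHodge

namespace Literature.NumberTheory.Automorphic

/-! ## 1. The self-twist `I ⊗ η ≅ I` read on Satake parameters: `t_{Π,v}` is stable under `-1` at
the places of `K'` inert in `E' = E K'` -/

section SelfTwist

variable {K E K' E' : Type} [Field K] [NumberField K] [Field E] [NumberField E] [Field K']
  [NumberField K'] [Field E'] [NumberField E'] [Algebra K E] [Algebra K K'] [Algebra K' E']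
  [Algebra E E'] [Algebra K E'] [IsScalarTower K K' E'] [IsScalarTower K E E']
  {p : ℕ} [Fact p.Prime] {n : ℕ}

/-- `a ↦ ι⁻¹((c a)⁻¹)` is injective for `c ≠ 0`. [folklore] -/
theorem injective_symm_inv_mul (ι : PadicAlgCl p ≃+* ℂ) {c : ℂ} (hc : c ≠ 0) :
    Function.Injective fun a : ℂ => ι.symm (c * a)⁻¹ :=
  ι.symm.injective.comp (inv_injective.comp (mul_right_injective₀ hc))

/-- **The self-twist on Satake parameters.**  Let `E/K` be quadratic Galois, `K'/K` Galois with
compositum `E'` quadratic over `K'`, `W : Γ_E → GL_n(ℚ̄_p)`, `I = Ind_E^K W`, and `Π` an automorphic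
representation of `GL_{2n}(𝔸_{K'})` with which `I|Γ_{K'}` is HLTT-compatible.  Then at almost every
place `v` of `K'` which is INERT in `E'`, every Satake parameter `α` of `Π` satisfies `{-a} = {a}`:
`I ⊗ η_{E/K} ≅ I` (`induce_twist_eq_conj`), `η_{E/K}(res Frob_v) = -1` (the diamond and
`not_mem_range_absGaloisRestrict_of_inert`), so the characteristic polynomial of `Frob_v` on `I|Γ_{K'}`
— whose roots are the `ι⁻¹((q_v^{(2n-1)/2} a)⁻¹)` — is that of `-Frob_v`. [folklore] -/
theorem eventually_satake_map_neg_eq [IsGalois K E] [IsGalois K K'] (hd : Module.finrank K E = 2)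
    (h2 : Module.finrank K' E' = 2)
    (hcomp : (IsScalarTower.toAlgHom K E E').fieldRange ⊔
      (IsScalarTower.toAlgHom K K' E').fieldRange = ⊤)
    (W : FramedGaloisRep E (PadicAlgCl p) n) (ι : PadicAlgCl p ≃+* ℂ)
    {hcpt : isCompact_glFiniteIntegralLevel (2 * n) K'}
    (π : AutomorphicRepData (AutomorphyDatum.gl (2 * n) K' hcpt))
    (hC : HarrisLanTaylorThorne2016.IsCompatible π ι ((W.induce K hd).restrictField K')) :
    ∀ᶠ v : HeightOneSpectrum (𝓞 K') in cofinite, ∀ (w : HeightOneSpectrum (𝓞 E')) (α : Multiset ℂ),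
      w.asIdeal.under (𝓞 K') = v.asIdeal → w.asIdeal.inertiaDeg (𝓞 K') = Module.finrank K' E' →
        π.HasSatakeParamAt v α → ∀ ζ : ℂ, IsPrimitiveRoot ζ (Module.finrank K' E') →
          α.map (ζ * ·) = α := by
  haveI : FiniteDimensional K E := Module.finite_of_finrank_eq_succ hd
  -- the good places: over a rational prime `q ≠ p` above which `π` is unramified, and unramified in `E'`
  have hfin := HarrisLanTaylorThorne2016.finite_setOf_not_exists_goodPrime π
    (AutomorphicRepData.hasSatakeParamAt_cofinite_holds π) p Fact.out
  have hunrE' : ∀ᶠ v : HeightOneSpectrum (𝓞 K') in cofinite, Algebra.IsUnramifiedIn (𝓞 E') v.asIdeal :=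
    Filter.eventually_cofinite.2 (finite_setOf_not_isUnramifiedIn K' E')
  filter_upwards [Filter.eventually_cofinite.2 hfin, hunrE'] with v hv hvE' w α hw hf hα ζ hζ
  rw [h2] at hζ hf
  rw [hζ.eq_neg_one_of_two_right]
  obtain ⟨q, hq, hqp, -, hπq, hqv⟩ := hv
  obtain ⟨hur, hch⟩ := hC q hq hqp hπq v hqv α hα
  -- a Frobenius at `v`
  obtain ⟨𝔓, h𝔓⟩ := HeightOneSpectrum.primesAbove_nonempty v
  obtain ⟨Φ, hΦ⟩ := HeightOneSpectrum.exists_isArithFrobAt_of_mem_primesAbove_holds h𝔓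
  -- `η(res Φ) = -1`
  haveI : NeZero (2 : PadicAlgCl p) := ⟨two_ne_zero⟩
  obtain ⟨η, hη1, hη2⟩ := exists_signChar_absGaloisRestrict K E (PadicAlgCl p) hd
  have hΦE' : Φ ∉ (absGaloisRestrict K' E').range :=
    not_mem_range_absGaloisRestrict_of_inert h2 hvE' hw hf h𝔓 hΦ
  have hηΦ : η (absGaloisRestrict K K' Φ) = -1 :=
    hη2 _ (mt (mem_range_absGaloisRestrict_iff_of_compositum hcomp Φ).mpr hΦE')
  -- `charpoly (I ⊗ η)(res Φ) = charpoly I(res Φ)` and `(I ⊗ η)(res Φ) = - I(res Φ)`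
  have hkey := FramedGaloisRep.charpoly_induce_twist_eq K hd W η
    (fun σ => hη1 _ ⟨σ, rfl⟩) (absGaloisRestrict K K' Φ)
  have hneg : (W.induce K hd).twist η (absGaloisRestrict K K' Φ) = -(W.induce K hd (absGaloisRestrict K K' Φ)) :=
    FramedRep.twist_apply_of_eq_neg_one _ _ hηΦ
  -- the Frobenius polynomial
  set c : ℂ := ((Real.sqrt (v.residueCard : ℝ) : ℝ) : ℂ) ^ (2 * n - 1) with hcdef
  have hc : c ≠ 0 := by
    apply pow_ne_zero
    have hq1 := v.one_lt_residueCard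
    exact Complex.ofReal_ne_zero.mpr (Real.sqrt_ne_zero'.mpr (by exact_mod_cast (by omega : 0 < v.residueCard)))
  set φ : ℂ → PadicAlgCl p := fun a => ι.symm (c * a)⁻¹ with hφdef
  have hA : arithFrobPolyOfSatake ι v.residueCard (2 * n) α = ((α.map φ).map fun b => X - C b).prod := by
    rw [arithFrobPolyOfSatake, Multiset.map_map]
    rfl
  have h1 : FramedRep.charpoly (W.induce K hd) (absGaloisRestrict K K' Φ) =
      ((α.map φ).map fun b => X - C b).prod := by
    rw [← hA]; exact hch 𝔓 h𝔓 Φ hΦ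
  have h2' : FramedRep.charpoly ((W.induce K hd).twist η) (absGaloisRestrict K K' Φ) =
      ((α.map φ).map fun b => X - C ((-1 : PadicAlgCl p) * b)).prod := by
    unfold FramedRep.charpoly
    rw [hneg, Units.val_neg, ← neg_one_smul (PadicAlgCl p)
      (((W.induce K hd) (absGaloisRestrict K K' Φ) : GL (Fin (2 * n)) (PadicAlgCl p)) :
        Matrix (Fin (2 * n)) (Fin (2 * n)) (PadicAlgCl p))]
    exact Matrix.charpoly_smul_of_eq_prod h1 (by norm_num)
  rw [hkey, h1] at h2'
  -- compare the root multisets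
  have hroots := congrArg Polynomial.roots h2'
  have hre : ((α.map φ).map fun b => X - C ((-1 : PadicAlgCl p) * b)) =
      (((α.map φ).map fun b => (-1 : PadicAlgCl p) * b).map fun b => X - C b) := by
    simp only [Multiset.map_map, Function.comp_def]
  rw [hre, Polynomial.roots_multiset_prod_X_sub_C, Polynomial.roots_multiset_prod_X_sub_C,
    Multiset.map_map] at hroots
  have hφneg : (fun b : PadicAlgCl p => (-1 : PadicAlgCl p) * b) ∘ φ = φ ∘ fun a : ℂ => (-1 : ℂ) * a := by
    funext a
    simp only [Function.comp_apply, hφdef, neg_one_mul, mul_neg, ← neg_inv, map_neg]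
  rw [hφneg, ← Multiset.map_map] at hroots
  exact (Multiset.map_injective (injective_symm_inv_mul ι hc) hroots).symm

end SelfTwist

/-! ## 2–3. Automorphic bookkeeping: regular algebraicity of the descended representation, and the
Frobenius polynomials of `r(Π₁) ⊕ r(Π₁^σ)` against those of `Ind|Γ_{E'}` -/

section RegularAlgebraic

variable {K' E' : Type} [Field K'] [NumberField K'] [Field E'] [NumberField E'] [Algebra K' E']

omit [NumberField K'] in
/-- `σ'` is one of the embeddings of `E'` over `σ = σ'|K'`, so `χ(σ') ≤ ∑_{σ'' ∣ σ} χ(σ'')`. [folklore] -/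
theorem le_sum_filter_comp (χ : (E' →+* ℂ) → Multiset ℂ) (σ' : E' →+* ℂ) :
    χ σ' ≤ ∑ σ'' ∈ Finset.univ.filter
      (fun σ'' : E' →+* ℂ => σ''.comp (algebraMap K' E') = σ'.comp (algebraMap K' E')), χ σ'' :=
  Finset.single_le_sum (f := χ) (fun _ _ => Multiset.zero_le _) (by simp)

/-- **The descended `Π₁` on `GL₂(𝔸_{E'})` is regular algebraic when `Π` on `GL₄(𝔸_{K'})` is**
(`E'/K'` cyclic quadratic, `Π` automorphically induced from `Π₁`): by Henniart's archimedean theorem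
(`Henniart2012_infinityType_of_automorphicInduction`) the `z`-exponents of an infinity type `T₁` of `Π₁`
at `σ'` are among those of an infinity type `T` of `Π` at `σ'|K'`; these are pairwise distinct and in
`3/2 + ℤ = 1/2 + ℤ`; the `z̄`-exponents of `T₁` at `σ'` are the `z`-exponents at `σ̄'` (well-formedness).
[cite: Henniart2012, Thm. 5 and Remarque §3.7] [cite: Clozel1990, Déf. 1.8, 3.12] -/
theorem isRegularAlgebraic_of_isAutomorphicInductionAlong_two_two
    (hH : Henniart2012_infinityType_of_automorphicInduction) [IsGalois K' E']
    (hcyc : IsCyclic (E' ≃ₐ[K'] E')) (h2 : Module.finrank K' E' = 2)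
    {hK : isCompact_glFiniteIntegralLevel (2 * 2) K'} {hE : isCompact_glFiniteIntegralLevel 2 E'}
    (P : CuspidalAutomorphicRepData (2 * 2) K' hK) (P₁ : CuspidalAutomorphicRepData 2 E' hE)
    (hAI : IsAutomorphicInductionAlong P₁.1 P.1) (hP : P.1.IsRegularAlgebraic)
    (hex : P₁.1.exists_hasInfinityType) : P₁.1.IsRegularAlgebraic := by
  obtain ⟨TP, hTP, hTPalg, hTPreg⟩ := hP
  obtain ⟨T, hT⟩ := hex
  have hrel := (Henniart2012_infinityType_of_automorphicInduction_iff_along.mp hH) K' E' hcyc 2 2 two_pos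
    h2 hK hE P P₁ hAI TP T hTP hT
  have hsub : ∀ σ' : E' →+* ℂ, (T σ').map ArchWeight.a ≤ (TP (σ'.comp (algebraMap K' E'))).map ArchWeight.a := by
    intro σ'
    rw [hrel]
    exact le_sum_filter_comp (fun σ'' => (T σ'').map ArchWeight.a) σ'
  -- the `z`-exponents of `T` are in `1/2 + ℤ`
  have ha : ∀ (σ' : E' →+* ℂ) (q : ArchWeight), q ∈ T σ' → ∃ k : ℤ, q.a = k + ((2 : ℂ) - 1) / 2 := by
    intro σ' q hq
    have hmem : q.a ∈ (TP (σ'.comp (algebraMap K' E'))).map ArchWeight.a :=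
      Multiset.mem_of_le (hsub σ') (Multiset.mem_map_of_mem _ hq)
    obtain ⟨q', hq', hqa⟩ := Multiset.mem_map.mp hmem
    obtain ⟨k, l, hk, -⟩ := hTPalg _ q' hq'
    refine ⟨k + 1, ?_⟩
    rw [← hqa, hk]
    push_cast
    ring
  refine ⟨T, hT, ⟨fun σ' q hq => ?_, fun σ' => Multiset.nodup_of_le (hsub σ') (hTPreg _)⟩⟩
  obtain ⟨k, hk⟩ := ha σ' q hq
  -- `q.swap ∈ T σ̄'`
  have hswap : q.swap ∈ T (NumberField.ComplexEmbedding.conjugate σ') := by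
    rw [hT.1.2 σ']
    exact Multiset.mem_map_of_mem _ hq
  obtain ⟨l, hl⟩ := ha _ q.swap hswap
  exact ⟨k, l, hk, hl⟩

end RegularAlgebraic

section FrobeniusMatch

variable {p : ℕ} [Fact p.Prime]

/-- `∏_{a} (X - ι⁻¹((q^{3/2} a)⁻¹)) = ∏_{a} (X - q⁻¹ · ι⁻¹((q^{1/2} a)⁻¹))`: the Frobenius polynomial
predicted on `GL₄` is the `ε⁻¹`-twist of the one predicted on `GL₂` (same unitary Satake entries).
[folklore] -/
theorem arithFrobPolyOfSatake_two_mul_two (ι : PadicAlgCl p ≃+* ℂ) (q : ℕ) (γ : Multiset ℂ) :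
    arithFrobPolyOfSatake ι q (2 * 2) γ =
      ((γ.map fun b => ι.symm ((((Real.sqrt q : ℝ) : ℂ) ^ (2 - 1) * b)⁻¹)).map
        fun b => X - C ((q : PadicAlgCl p) ^ (-1 : ℤ) * b)).prod := by
  rw [arithFrobPolyOfSatake, Multiset.map_map]
  congr 1
  refine Multiset.map_congr rfl fun b _ => ?_
  have hsq : (((Real.sqrt q : ℝ) : ℂ)) ^ 2 = (q : ℂ) := by
    rw [← Complex.ofReal_pow, Real.sq_sqrt (Nat.cast_nonneg _), Complex.ofReal_natCast]
  simp only [Function.comp_apply]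
  rw [show (2 * 2 - 1 : ℕ) = 2 + 1 from rfl, pow_succ, hsq, show (2 - 1 : ℕ) = 1 from rfl, pow_one,
    mul_assoc, mul_inv, map_mul, map_inv₀, map_natCast, zpow_neg_one]

variable {K' E' : Type} [Field K'] [NumberField K'] [Field E'] [NumberField E'] [Algebra K' E']

/-- In a quadratic Galois extension, `Gal = {1, σ₀}` for any `σ₀ ≠ 1`. [folklore] -/
theorem univ_eq_pair_of_finrank_eq_two [IsGalois K' E'] (h2 : Module.finrank K' E' = 2)
    {σ₀ : E' ≃ₐ[K'] E'} (hσ₀ : σ₀ ≠ 1) : (Finset.univ : Finset (E' ≃ₐ[K'] E')) = {1, σ₀} := by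
  haveI : FiniteDimensional K' E' := Module.finite_of_finrank_eq_succ h2
  symm
  apply Finset.eq_univ_of_card
  rw [Finset.card_pair (Ne.symm hσ₀), ← Nat.card_eq_fintype_card, IsGalois.card_aut_eq_finrank, h2]

/-- **The Frobenius polynomials of `(r(Π₁) ⊗ ε⁻¹) ⊞ (r(Π₁^σ) ⊗ ε⁻¹)` are those of `R|Γ_{E'}` almost
everywhere.**  Setting: `E'/K'` quadratic Galois with `Gal(E'/K') = {1, σ₀}`; `R : Γ_{K'} → GL₄(ℚ̄_p)`
HLTT-compatible with `P` on `GL₄(𝔸_{K'})`; `P` automorphically induced from the cuspidal `Π 1` on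
`GL₂(𝔸_{E'})`, and `Π σ₀` its Galois conjugate on Satake parameters; `r τ` HLTT-compatible with `Π τ`;
`ε' = ε_p^{-1}`.  At almost every place `w` of `E'` over `v` (residue degree `f`):
`t_{P,v}^f = t_{Π₁,w} + t_{Π₁,σ₀ w}` (Def. 6.1 read through
`Multiset.map_pow_eq_nsmul_sum_of_satakePolynomial_eq` and the orbit count `#D_w = f`), the
characteristic polynomial of `Frob_w` on `R|Γ_{E'}` is the `GL₄`-prediction at `t_{P,v}^f`
(`hasFrobCharpolyAt_restrictField_arithFrobPolyOfSatake`), and that is the product of the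
`ε⁻¹`-twisted `GL₂`-predictions (`arithFrobPolyOfSatake_two_mul_two`).
[cite: ArthurClozelAMS120, Ch. 3 Def. 6.1 and (1.1)] [cite: HarrisLanTaylorThorneRMS2016, Thm. A] -/
theorem eventually_frobenius_match [IsGalois K' E'] (h2 : Module.finrank K' E' = 2)
    {σ₀ : E' ≃ₐ[K'] E'} (hσ₀ : σ₀ ≠ 1) (ι : PadicAlgCl p ≃+* ℂ)
    {hK : isCompact_glFiniteIntegralLevel (2 * 2) K'} {hE : isCompact_glFiniteIntegralLevel 2 E'}
    (P : AutomorphicRepData (AutomorphyDatum.gl (2 * 2) K' hK))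
    (R : FramedGaloisRep K' (PadicAlgCl p) (2 * 2)) (hR : HarrisLanTaylorThorne2016.IsCompatible P ι R)
    (Pf : (E' ≃ₐ[K'] E') → CuspidalAutomorphicRepData 2 E' hE)
    (hconj : ∀ᶠ w : HeightOneSpectrum (𝓞 E') in cofinite, ∀ β : Multiset ℂ,
      (Pf 1).1.HasSatakeParamAt (σ₀ • w) β → (Pf σ₀).1.HasSatakeParamAt w β)
    (hAI : IsAutomorphicInductionAlong (Pf 1).1 P)
    (r : (E' ≃ₐ[K'] E') → FramedGaloisRep E' (PadicAlgCl p) 2)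
    (hr : ∀ τ, HarrisLanTaylorThorne2016.IsCompatible (Pf τ).1 ι (r τ))
    {ε' : absoluteGaloisGroup E' →ₜ* (PadicAlgCl p)ˣ}
    (hε' : ∀ σ, (ε' σ : PadicAlgCl p) =
      (algebraMap ℚ_[p] (PadicAlgCl p) ((GaloisRep.cyclotomicCharacter E' p σ : ℤ_[p]ˣ) : ℤ_[p])) ^ (-1 : ℤ)) :
    ∀ᶠ w : HeightOneSpectrum (𝓞 E') in cofinite,
      (R.restrictField E').IsUnramifiedAt w ∧
        FramedGaloisRep.IsUnramifiedAt w (FramedRep.blockSum ((r 1).twist ε') ((r σ₀).twist ε')) ∧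
        ∃ Q : Polynomial (PadicAlgCl p), (R.restrictField E').HasFrobCharpolyAt w Q ∧
          FramedGaloisRep.HasFrobCharpolyAt w Q (FramedRep.blockSum ((r 1).twist ε') ((r σ₀).twist ε')) := by
  haveI : FiniteDimensional K' E' := Module.finite_of_finrank_eq_succ h2
  have hp : p.Prime := Fact.out
  -- (a) good places of `K'` for `P`
  have hgoodP := Filter.eventually_cofinite.2 (HarrisLanTaylorThorne2016.finite_setOf_not_exists_goodPrime P
    (AutomorphicRepData.hasSatakeParamAt_cofinite_holds P) p hp)
  -- (b) good places of `E'` for `Π 1` and `Π σ₀`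
  have hgood1 := Filter.eventually_cofinite.2 (HarrisLanTaylorThorne2016.finite_setOf_not_exists_goodPrime
    (Pf 1).1 (AutomorphicRepData.hasSatakeParamAt_cofinite_holds (Pf 1).1) p hp)
  have hgoodσ := Filter.eventually_cofinite.2 (HarrisLanTaylorThorne2016.finite_setOf_not_exists_goodPrime
    (Pf σ₀).1 (AutomorphicRepData.hasSatakeParamAt_cofinite_holds (Pf σ₀).1) p hp)
  -- (e) Satake parameters of `Π 1` above almost every `v`, (g) unramified places
  have hβ := (Pf 1).1.eventually_exists_forall_hasSatakeParamAt_above (K := K')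
  have hunr : ∀ᶠ v : HeightOneSpectrum (𝓞 K') in cofinite, Algebra.IsUnramifiedIn (𝓞 E') v.asIdeal :=
    Filter.eventually_cofinite.2 (finite_setOf_not_isUnramifiedIn K' E')
  filter_upwards [eventually_under (E := E') (hgoodP.and ((hAI.and hβ).and hunr)), hgood1, hgoodσ, hconj]
    with w hw hw1 hwσ hconjw
  obtain ⟨⟨q, hq, hqp, -, hPq, hqv⟩, ⟨hAIv, ⟨β, hβ⟩⟩, hvu⟩ := hw (w.under (𝓞 K')) rfl
  obtain ⟨q₁, hq₁, hq₁p, -, hP1q, hq₁w⟩ := hw1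
  obtain ⟨q₂, hq₂, hq₂p, -, hP2q, hq₂w⟩ := hwσ
  have hpw : ((p : ℕ) : 𝓞 E') ∉ w.asIdeal := natCast_not_mem_of_natCast_mem hq₁ hp hq₁p hq₁w
  -- the relation `t_{P,v}^f = β w + β (σ₀ w)`
  obtain ⟨α, hα, hαβ⟩ := hAIv β hβ
  set v := w.under (𝓞 K') with hvdef
  set f := w.asIdeal.inertiaDeg (𝓞 K') with hfdef
  have hfpos : 0 < f := by
    haveI : (w.asIdeal.under (𝓞 K')).IsMaximal := (w.under (𝓞 K')).isMaximal
    exact Ideal.inertiaDeg_pos _ _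
  have hS := Literature.NumberTheory.Automorphic.finite_setOf_asIdeal_under_eq (E := E') v
  have hf' : ∀ w' ∈ hS.toFinset, w'.asIdeal.inertiaDeg (𝓞 K') = f := by
    intro w' hw'
    rw [hfdef, inertiaDeg_eq_inertiaDegIn_of_under_eq v (hS.mem_toFinset.mp hw'),
      inertiaDeg_eq_inertiaDegIn_of_under_eq v rfl]
  have hrel : satakePolynomial α = ∏ w' ∈ hS.toFinset, (satakePolynomial (β w')).comp (X ^ f) := by
    rw [hαβ, inducedSatakePolynomial, finprod_mem_eq_finite_toFinset_prod _ hS]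
    exact Finset.prod_congr rfl fun w' hw' => by rw [hf' w' hw']
  have hpow := Multiset.map_pow_eq_nsmul_sum_of_satakePolynomial_eq hS.toFinset β hfpos hrel
  have hcard : Nat.card (MulAction.stabilizer (E' ≃ₐ[K'] E') w) = f :=
    card_stabilizer_algEquiv_eq_inertiaDeg_of_isUnramifiedIn K' w hvu
  have hsum : f • ∑ w' ∈ hS.toFinset, β w' = ∑ g : E' ≃ₐ[K'] E', β (g • w) := by
    rw [← hcard]
    exact (sum_algEquiv_smul_eq_card_stabilizer_nsmul_sum K' β w).symm
  rw [hsum, univ_eq_pair_of_finrank_eq_two h2 hσ₀, Finset.sum_pair (Ne.symm hσ₀), one_smul] at hpow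
  -- Frobenius of `R|Γ_{E'}` at `w`
  obtain ⟨hRur, hRch⟩ := hR q hq hqp hPq v hqv α hα
  obtain ⟨hRur', hRch'⟩ := hasFrobCharpolyAt_restrictField_arithFrobPolyOfSatake (L := E') ι R
    (v := v) (w := w) rfl hRur (2 * 2) hRch
  rw [← hfdef, hpow, arithFrobPolyOfSatake_two_mul_two, Multiset.map_add, Multiset.map_add,
    Multiset.prod_add] at hRch'
  -- Frobenius of `r 1 ⊗ ε'` and `r σ₀ ⊗ ε'` at `w`
  have hβw : (Pf 1).1.HasSatakeParamAt w (β w) := hβ w rfl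
  have hβσ : (Pf σ₀).1.HasSatakeParamAt w (β (σ₀ • w)) :=
    hconjw _ (hβ (σ₀ • w) (congrArg HeightOneSpectrum.asIdeal (HeightOneSpectrum.under_algEquiv_smul K' E' σ₀ w)))
  obtain ⟨h1ur, h1ch⟩ := hr 1 q₁ hq₁ hq₁p hP1q w hq₁w (β w) hβw
  obtain ⟨hσur, hσch⟩ := hr σ₀ q₂ hq₂ hq₂p hP2q w hq₂w (β (σ₀ • w)) hβσ
  set φ₂ : ℂ → PadicAlgCl p := fun b => ι.symm ((((Real.sqrt w.residueCard : ℝ) : ℂ) ^ (2 - 1) * b)⁻¹)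
    with hφ₂
  have hA2 : ∀ γ : Multiset ℂ, arithFrobPolyOfSatake ι w.residueCard 2 γ =
      ((γ.map φ₂).map fun b => X - C b).prod := fun γ => by
    rw [arithFrobPolyOfSatake, Multiset.map_map]; rfl
  rw [hA2] at h1ch hσch
  have htw : ∀ {ρ : FramedGaloisRep E' (PadicAlgCl p) 2} {γ : Multiset ℂ}, ρ.IsUnramifiedAt w →
      ρ.HasFrobCharpolyAt w ((γ.map φ₂).map fun b => X - C b).prod →
      FramedGaloisRep.IsUnramifiedAt w (ρ.twist ε') ∧
        FramedGaloisRep.HasFrobCharpolyAt w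
          ((γ.map φ₂).map fun b => X - C ((w.residueCard : PadicAlgCl p) ^ (-1 : ℤ) * b)).prod (ρ.twist ε') :=
    fun hur hch => ⟨FramedGaloisRep.isUnramifiedAt_twist hur fun 𝔓 h𝔓 σ hσ =>
        eq_one_of_mem_inertia_of_cyclotomic_zpow hε' hpw h𝔓 hσ,
      FramedGaloisRep.hasFrobCharpolyAt_twist_of_eq_prod hch fun 𝔓 h𝔓 σ hσ =>
        coe_apply_of_isArithFrobAt_of_cyclotomic_zpow hε' hpw h𝔓 hσ⟩
  obtain ⟨h1ur', h1ch'⟩ := htw h1ur h1ch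
  obtain ⟨hσur', hσch'⟩ := htw hσur hσch
  exact ⟨hRur', h1ur'.blockSum hσur', _, hRch', h1ch'.blockSum hσch'⟩

end FrobeniusMatch

end Literature.NumberTheory.Automorphic

end
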